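import Summits.Ventures.WeilGRH.TwistedPrimeFormBound
import Summits.RiemannHypothesis.RiemannHypothesis.Theorems.WeilFormatCColumnEven
import HarnessLib

/-!
# GRH arm (rh-explicit, venture WeilGRH): L-C3b order 1 for a character — the far COLUMNS of the sector kernels of
  `twistedGramCoeff χ a` are one structured direction plus `O(κ(i)/m²)`

Cell `rh-explicit`, WEIL TRACK — GRH ARM (lit/typing seat weil-grh-5 gen11).  Twisted analogue of weil-10's
`WeilFormatCColumnEven.lean` / `WeilFormatCColumnOdd.lean` (FORMATC-DESIGN §4.2/§9.5): the coupling columns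
`b_m(i) = M^±(i,m)` (block row `i`, far column `m ≥ 2i`) of the kernel `G = twistedGramCoeff χ a`
(`TwistedGramEvenReal.lean`).  By `twistedGramCoeff_eq_arch_add_prime_add_conductor` a column is the ARCHIMEDEAN column of
`ζ` (weil-10's `abs_evenArch_col_sub_le` / `abs_oddArch_col_sub_le`, reused verbatim) plus the TWISTED PRIME column (prime
jumps re-weighted by `Re χ(k)`, `|Re χ(k)| ≤ 1`) — the conductor `(log q)δ` has no off-diagonal entries and there is NO
pole column.  With `ω = π·/a`, `ΛΣ = Σ_{k∈weilPrimeIndex a} Λ(k)k^{−1/2}`, `E = weilArchDensity(2a)`, `Y_i = Im ψ(¼+iω_i/2)`,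
`T_i = archExpSumSin a i`:

* `abs_evenTwistedKernel_col_sub_le` — `|M⁺(i,m) − (−1)^{i+m} g^χ_m/(4m)| ≤ κ⁺_χ(i)/m²` (`1 ≤ m`, `2i ≤ m`),
  `g^χ_m = 1 + (4/π)Σ_k Re χ(k)(Λ_k/√k) sin(ω_m log k)`, `κ⁺_χ(i) = 2iΛΣ/π + i/2 + 8a(1+E)/(3π²)`;
* `abs_oddTwistedKernel_col_sub_le` — `|M⁻(i,m) − (−1)^{i+m} v⁻_χ(i)/m| ≤ κ⁻_χ(i)/m²` (`1 ≤ i`, `2i ≤ m`),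
  `v⁻_χ(i) = −Σ_k Re χ(k)(Λ_k/√k) sin(ω_i log k)/π − Y_i/(2π) + T_i/π`, `κ⁻_χ(i) = 2iΛΣ/π + i/2 + 4a(1+E)/(3π²)`

— the `ζ` constants with the pole terms deleted; inputs of the order-1 tail majorant (`WeilFormatC.tailMajorant`) for a
twisted `…_of_formatC_data` front door.  Elementary; standard axioms; no definitions; no named facts; RH/GRH-free.
-/

set_option autoImplicit false

noncomputable section

open Complex Finset
open scoped Real BigOperators ArithmeticFunction.vonMangoldt

namespace Summit.Ventures.WeilGRH

open Literature.NumberTheory.LFunctions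
open Literature.NumberTheory.LFunctions.Yoshida1992 (freq incrCoeff archCoeff archExpSumSin)
open Literature.Analysis.SpecialFunctions
open Summit.RiemannHypothesis.RiemannHypothesis.Theorems.WeilFormatC

variable {q : ℕ} {a : ℝ}

/-! ## Even sector -/

section Even

/-- **Twisted prime column, even sector**: for weights `w` and `0 ≤ i < m`,
`M⁺_{T_w}(i,m) = (−1)^{i+m} Σ_k w_k(Λ_k/√k)(m sin ω_mℓ_k − i sin ω_iℓ_k)/(π(m²−i²))`. -/
theorem evenTwistedPrime_col_eq (w : ℕ → ℝ) (a : ℝ) {i m : ℕ} (hm : 1 ≤ m) (him : i < m) :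
    (if i = 0 then (∑ k ∈ weilPrimeIndex a, w k * ((Λ k : ℝ) / Real.sqrt k) *
          (incrCoeff a (Real.log k) 0 m - if (0 : ℤ) = m then 2 else 0))
      else if m = 0 then (∑ k ∈ weilPrimeIndex a, w k * ((Λ k : ℝ) / Real.sqrt k) *
          (incrCoeff a (Real.log k) i 0 - if (i : ℤ) = 0 then 2 else 0))
      else ((∑ k ∈ weilPrimeIndex a, w k * ((Λ k : ℝ) / Real.sqrt k) *
          (incrCoeff a (Real.log k) i m - if (i : ℤ) = m then 2 else 0)) +
        (∑ k ∈ weilPrimeIndex a, w k * ((Λ k : ℝ) / Real.sqrt k) *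
          (incrCoeff a (Real.log k) i (-(m : ℤ)) - if (i : ℤ) = -(m : ℤ) then 2 else 0))) / 2)
      = (-1 : ℝ) ^ ((i : ℤ) + m) * ∑ k ∈ weilPrimeIndex a, w k * ((Λ k : ℝ) / Real.sqrt k) *
          (((m : ℝ) * Real.sin (freq a m * Real.log k) - i * Real.sin (freq a i * Real.log k))
            / (π * ((m : ℝ) ^ 2 - i ^ 2))) := by
  have hm0 : (0 : ℝ) < m := by exact_mod_cast hm
  have hd1 : (i : ℝ) - m ≠ 0 := sub_ne_zero.mpr (by exact_mod_cast (ne_of_lt him))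
  have hd1' : (m : ℝ) - i ≠ 0 := sub_ne_zero.mpr (by exact_mod_cast (ne_of_gt him))
  have hd2 : (0 : ℝ) < (i : ℝ) + m := by positivity
  have hD : (m : ℝ) ^ 2 - i ^ 2 ≠ 0 := by rw [sq_sub_sq]; exact mul_ne_zero (by positivity) hd1'
  have h1 : (i : ℤ) ≠ m := by exact_mod_cast (ne_of_lt him)
  have h2 : (i : ℤ) ≠ -(m : ℤ) := by omega
  by_cases hi : i = 0
  · subst hi
    rw [if_pos rfl, Finset.mul_sum]
    refine Finset.sum_congr rfl fun k _ ↦ ?_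
    have h0m : (0 : ℤ) ≠ m := by exact_mod_cast h1
    have hm' : (m : ℝ) ≠ 0 := hm0.ne'
    unfold incrCoeff
    simp only [if_neg h0m, freq_zero]
    push_cast
    simp only [zero_mul, Real.sin_zero, sub_zero, zero_sub]
    generalize (Λ k : ℝ) / Real.sqrt k = u
    generalize Real.sin (freq a m * Real.log k) = sm
    field_simp
    ring
  · rw [if_neg hi, if_neg (by omega), ← Finset.sum_add_distrib, Finset.sum_div, Finset.mul_sum]
    refine Finset.sum_congr rfl fun k _ ↦ ?_
    unfold incrCoeff
    rw [if_neg h1, if_neg h2, if_neg h1, if_neg h2, freq_neg, neg_one_zpow_add_neg]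
    push_cast
    simp only [neg_mul, Real.sin_neg, sub_neg_eq_add, sub_zero]
    have hd2' : (i : ℝ) + m ≠ 0 := hd2.ne'
    generalize (Λ k : ℝ) / Real.sqrt k = u
    generalize Real.sin (freq a m * Real.log k) = sm
    generalize Real.sin (freq a i * Real.log k) = si
    field_simp
    ring

/-- **Twisted prime column remainder, even sector**: for `|w_k| ≤ 1`, `1 ≤ m`, `2i ≤ m`:
`|M⁺_{T_w}(i,m) − (−1)^{i+m}(Σ_k w_k(Λ_k/√k) sin ω_mℓ_k)/(πm)| ≤ (2iΛΣ/π)/m²`. -/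
theorem abs_evenTwistedPrime_col_sub_le (w : ℕ → ℝ) (hw : ∀ k, |w k| ≤ 1) (a : ℝ) {i m : ℕ} (hm : 1 ≤ m)
    (him : 2 * i ≤ m) :
    |(if i = 0 then (∑ k ∈ weilPrimeIndex a, w k * ((Λ k : ℝ) / Real.sqrt k) *
          (incrCoeff a (Real.log k) 0 m - if (0 : ℤ) = m then 2 else 0))
      else if m = 0 then (∑ k ∈ weilPrimeIndex a, w k * ((Λ k : ℝ) / Real.sqrt k) *
          (incrCoeff a (Real.log k) i 0 - if (i : ℤ) = 0 then 2 else 0))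
      else ((∑ k ∈ weilPrimeIndex a, w k * ((Λ k : ℝ) / Real.sqrt k) *
          (incrCoeff a (Real.log k) i m - if (i : ℤ) = m then 2 else 0)) +
        (∑ k ∈ weilPrimeIndex a, w k * ((Λ k : ℝ) / Real.sqrt k) *
          (incrCoeff a (Real.log k) i (-(m : ℤ)) - if (i : ℤ) = -(m : ℤ) then 2 else 0))) / 2)
      - (-1 : ℝ) ^ ((i : ℤ) + m) *
        (∑ k ∈ weilPrimeIndex a, w k * ((Λ k : ℝ) / Real.sqrt k) * Real.sin (freq a m * Real.log k)) / (π * m)|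
      ≤ (2 * i * (∑ k ∈ weilPrimeIndex a, (Λ k : ℝ) / Real.sqrt k) / π) / (m : ℝ) ^ 2 := by
  have him' : i < m := by omega
  have hm0 : (0 : ℝ) < m := by exact_mod_cast hm
  have hi0 : (0 : ℝ) ≤ i := by positivity
  obtain ⟨hD34, hihalf, hDpos⟩ := col_index_bounds' hm him
  rw [evenTwistedPrime_col_eq w a hm him']
  have e : (-1 : ℝ) ^ ((i : ℤ) + m) * ∑ k ∈ weilPrimeIndex a, w k * ((Λ k : ℝ) / Real.sqrt k) *
          (((m : ℝ) * Real.sin (freq a m * Real.log k) - i * Real.sin (freq a i * Real.log k))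
            / (π * ((m : ℝ) ^ 2 - i ^ 2)))
        - (-1 : ℝ) ^ ((i : ℤ) + m) *
          (∑ k ∈ weilPrimeIndex a, w k * ((Λ k : ℝ) / Real.sqrt k) * Real.sin (freq a m * Real.log k)) / (π * m)
      = (-1 : ℝ) ^ ((i : ℤ) + m) * ∑ k ∈ weilPrimeIndex a, w k * ((Λ k : ℝ) / Real.sqrt k) *
          ((((m : ℝ) * Real.sin (freq a m * Real.log k) - i * Real.sin (freq a i * Real.log k))
            / (π * ((m : ℝ) ^ 2 - i ^ 2))) - Real.sin (freq a m * Real.log k) / (π * m)) := by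
    rw [mul_div_assoc, Finset.sum_div, ← mul_sub, ← Finset.sum_sub_distrib]
    congr 1
    exact Finset.sum_congr rfl fun k _ ↦ by ring
  rw [e, abs_mul, abs_neg_one_zpow_natCast_add', one_mul]
  have hK : ∀ k ∈ weilPrimeIndex a,
      |w k * ((Λ k : ℝ) / Real.sqrt k) *
        ((((m : ℝ) * Real.sin (freq a m * Real.log k) - i * Real.sin (freq a i * Real.log k))
          / (π * ((m : ℝ) ^ 2 - i ^ 2))) - Real.sin (freq a m * Real.log k) / (π * m))|
        ≤ (Λ k : ℝ) / Real.sqrt k * (2 * i / (π * m ^ 2)) := by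
    intro k _
    have hu : 0 ≤ (Λ k : ℝ) / Real.sqrt k := div_nonneg ArithmeticFunction.vonMangoldt_nonneg (Real.sqrt_nonneg _)
    rw [abs_mul, abs_mul, abs_of_nonneg hu]
    have hsm := Real.abs_sin_le_one (freq a m * Real.log k)
    have hsi := Real.abs_sin_le_one (freq a i * Real.log k)
    generalize Real.sin (freq a m * Real.log k) = sm at hsm ⊢
    generalize Real.sin (freq a i * Real.log k) = si at hsi ⊢
    have e : ((m : ℝ) * sm - i * si) / (π * ((m : ℝ) ^ 2 - i ^ 2)) - sm / (π * m)
        = ((i : ℝ) ^ 2 * sm - i * m * si) / (π * m * ((m : ℝ) ^ 2 - i ^ 2)) := by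
      field_simp
      ring
    have hrest : |((m : ℝ) * sm - i * si) / (π * ((m : ℝ) ^ 2 - i ^ 2)) - sm / (π * m)| ≤ 2 * i / (π * m ^ 2) := by
      rw [e, abs_div, abs_of_pos (by positivity : (0 : ℝ) < π * m * ((m : ℝ) ^ 2 - i ^ 2)),
        div_le_div_iff₀ (by positivity) (by positivity)]
      have hnum : |(i : ℝ) ^ 2 * sm - i * m * si| ≤ (i : ℝ) ^ 2 + i * m := by
        have h1 : |(i : ℝ) ^ 2 * sm| ≤ (i : ℝ) ^ 2 := by
          rw [abs_mul, abs_of_nonneg (by positivity : (0 : ℝ) ≤ (i : ℝ) ^ 2)]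
          exact mul_le_of_le_one_right (by positivity) hsm
        have h2 : |(i : ℝ) * m * si| ≤ (i : ℝ) * m := by
          rw [abs_mul, abs_of_nonneg (by positivity : (0 : ℝ) ≤ (i : ℝ) * m)]
          exact mul_le_of_le_one_right (by positivity) hsi
        exact (abs_sub _ _).trans (add_le_add h1 h2)
      have hlhs := mul_le_mul_of_nonneg_right hnum (by positivity : (0 : ℝ) ≤ π * m ^ 2)
      refine hlhs.trans ?_
      have h2i : (0 : ℝ) ≤ m - 2 * i := by
        have : 2 * (i : ℝ) ≤ m := by exact_mod_cast him
        linarith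
      have key : 0 ≤ π * i * m * ((m : ℝ) + i) * (m - 2 * i) := by positivity
      nlinarith [key]
    calc |w k| * ((Λ k : ℝ) / Real.sqrt k) *
          |((m : ℝ) * sm - i * si) / (π * ((m : ℝ) ^ 2 - i ^ 2)) - sm / (π * m)|
        ≤ 1 * ((Λ k : ℝ) / Real.sqrt k) * (2 * i / (π * m ^ 2)) :=
          mul_le_mul (mul_le_mul_of_nonneg_right (hw k) hu) hrest (abs_nonneg _) (by positivity)
      _ = _ := by ring
  refine (Finset.abs_sum_le_sum_abs _ _).trans ((Finset.sum_le_sum hK).trans (le_of_eq ?_))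
  rw [← Finset.sum_mul]
  field_simp

/-- **Order-1 column structure for a character, even sector.**  For `a > 0`, `1 ≤ m`, `2i ≤ m`:
`|M⁺_{twistedGramCoeff χ a}(i,m) − (−1)^{i+m} g^χ_m/(4m)| ≤ κ⁺_χ(i)/m²` with
`g^χ_m = 1 + (4/π)Σ_k Re χ(k)(Λ_k/√k) sin(ω_m log k)` and `κ⁺_χ(i) = 2iΛΣ/π + i/2 + 8a(1+E)/(3π²)` (no pole term). -/
theorem abs_evenTwistedKernel_col_sub_le (χ : DirichletCharacter ℂ q) (ha : 0 < a) {i m : ℕ} (hm : 1 ≤ m)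
    (him : 2 * i ≤ m) :
    |(if i = 0 then twistedGramCoeff χ a 0 m else if m = 0 then twistedGramCoeff χ a i 0
        else (twistedGramCoeff χ a i m + twistedGramCoeff χ a i (-(m : ℤ))) / 2)
      - (-1 : ℝ) ^ ((i : ℤ) + m) *
        (1 + 4 / π * ∑ k ∈ weilPrimeIndex a,
          (χ (k : ZMod q)).re * ((Λ k : ℝ) / Real.sqrt k) * Real.sin (freq a m * Real.log k)) / (4 * m)|
      ≤ (2 * i * (∑ k ∈ weilPrimeIndex a, (Λ k : ℝ) / Real.sqrt k) / π
          + ((i : ℝ) / 2 + 8 * a * (1 + weilArchDensity (2 * a)) / (3 * π ^ 2))) / (m : ℝ) ^ 2 := by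
  have him' : i < m := by omega
  have hm0 : (0 : ℝ) < m := by exact_mod_cast hm
  have h1 : (i : ℤ) ≠ m := by exact_mod_cast (ne_of_lt him')
  have h2 : (i : ℤ) ≠ -(m : ℤ) := by omega
  have h0m : (0 : ℤ) ≠ m := by exact_mod_cast (show (0 : ℕ) ≠ m by omega)
  have hw1 : ∀ k, |(fun k : ℕ ↦ (χ (k : ZMod q)).re) k| ≤ 1 := fun k ↦ abs_re_apply_le_one χ k
  -- split the kernel column: arch + twisted prime (the conductor has no off-diagonal entries)
  have hsplit : (if i = 0 then twistedGramCoeff χ a 0 m else if m = 0 then twistedGramCoeff χ a i 0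
        else (twistedGramCoeff χ a i m + twistedGramCoeff χ a i (-(m : ℤ))) / 2)
      = (if i = 0 then (∑ k ∈ weilPrimeIndex a, (χ (k : ZMod q)).re * ((Λ k : ℝ) / Real.sqrt k) *
            (incrCoeff a (Real.log k) 0 m - if (0 : ℤ) = m then 2 else 0))
          else if m = 0 then (∑ k ∈ weilPrimeIndex a, (χ (k : ZMod q)).re * ((Λ k : ℝ) / Real.sqrt k) *
            (incrCoeff a (Real.log k) i 0 - if (i : ℤ) = 0 then 2 else 0))
          else ((∑ k ∈ weilPrimeIndex a, (χ (k : ZMod q)).re * ((Λ k : ℝ) / Real.sqrt k) *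
            (incrCoeff a (Real.log k) i m - if (i : ℤ) = m then 2 else 0)) +
            (∑ k ∈ weilPrimeIndex a, (χ (k : ZMod q)).re * ((Λ k : ℝ) / Real.sqrt k) *
            (incrCoeff a (Real.log k) i (-(m : ℤ)) - if (i : ℤ) = -(m : ℤ) then 2 else 0))) / 2)
        + (if i = 0 then archCoeff a 0 m else if m = 0 then archCoeff a i 0
          else (archCoeff a i m + archCoeff a i (-(m : ℤ))) / 2) := by
    by_cases hi : i = 0
    · subst hi
      simp only [if_true]
      rw [twistedGramCoeff_eq_arch_add_prime_add_conductor]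
      simp only [if_neg h0m]
      ring
    · have hm' : m ≠ 0 := by omega
      simp only [if_neg hi, if_neg hm']
      rw [twistedGramCoeff_eq_arch_add_prime_add_conductor, twistedGramCoeff_eq_arch_add_prime_add_conductor]
      simp only [if_neg h1, if_neg h2]
      ring
  have hQ := abs_evenTwistedPrime_col_sub_le (fun k : ℕ ↦ (χ (k : ZMod q)).re) hw1 a hm him
  beta_reduce at hQ
  have hR := abs_evenArch_col_sub_le ha hm him
  have e : (if i = 0 then twistedGramCoeff χ a 0 m else if m = 0 then twistedGramCoeff χ a i 0
        else (twistedGramCoeff χ a i m + twistedGramCoeff χ a i (-(m : ℤ))) / 2)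
      - (-1 : ℝ) ^ ((i : ℤ) + m) *
        (1 + 4 / π * ∑ k ∈ weilPrimeIndex a,
          (χ (k : ZMod q)).re * ((Λ k : ℝ) / Real.sqrt k) * Real.sin (freq a m * Real.log k)) / (4 * m)
      = ((if i = 0 then (∑ k ∈ weilPrimeIndex a, (χ (k : ZMod q)).re * ((Λ k : ℝ) / Real.sqrt k) *
            (incrCoeff a (Real.log k) 0 m - if (0 : ℤ) = m then 2 else 0))
          else if m = 0 then (∑ k ∈ weilPrimeIndex a, (χ (k : ZMod q)).re * ((Λ k : ℝ) / Real.sqrt k) *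
            (incrCoeff a (Real.log k) i 0 - if (i : ℤ) = 0 then 2 else 0))
          else ((∑ k ∈ weilPrimeIndex a, (χ (k : ZMod q)).re * ((Λ k : ℝ) / Real.sqrt k) *
            (incrCoeff a (Real.log k) i m - if (i : ℤ) = m then 2 else 0)) +
            (∑ k ∈ weilPrimeIndex a, (χ (k : ZMod q)).re * ((Λ k : ℝ) / Real.sqrt k) *
            (incrCoeff a (Real.log k) i (-(m : ℤ)) - if (i : ℤ) = -(m : ℤ) then 2 else 0))) / 2)
          - (-1 : ℝ) ^ ((i : ℤ) + m) *
            (∑ k ∈ weilPrimeIndex a, (χ (k : ZMod q)).re * ((Λ k : ℝ) / Real.sqrt k) *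
              Real.sin (freq a m * Real.log k)) / (π * m))
        + ((if i = 0 then archCoeff a 0 m else if m = 0 then archCoeff a i 0
            else (archCoeff a i m + archCoeff a i (-(m : ℤ))) / 2)
          - (-1 : ℝ) ^ ((i : ℤ) + m) / (4 * m)) := by
    rw [hsplit]
    field_simp
    ring
  rw [e]
  refine ((abs_add_le _ _).trans (add_le_add hQ hR)).trans (le_of_eq ?_)
  ring

end Even

/-! ## Odd sector -/

section Odd

/-- **Twisted prime column, odd sector**: for weights `w` and `1 ≤ i < m`,
`(T_w(i,m) − T_w(i,−m))/2 = (−1)^{i+m} Σ_k w_k(Λ_k/√k)(i sin ω_mℓ_k − m sin ω_iℓ_k)/(π(m²−i²))`. -/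
theorem oddTwistedPrime_col_eq (w : ℕ → ℝ) (a : ℝ) {i m : ℕ} (hi : 1 ≤ i) (him : i < m) :
    ((∑ k ∈ weilPrimeIndex a, w k * ((Λ k : ℝ) / Real.sqrt k) *
        (incrCoeff a (Real.log k) i m - if (i : ℤ) = m then 2 else 0)) -
      (∑ k ∈ weilPrimeIndex a, w k * ((Λ k : ℝ) / Real.sqrt k) *
        (incrCoeff a (Real.log k) i (-(m : ℤ)) - if (i : ℤ) = -(m : ℤ) then 2 else 0))) / 2
      = (-1 : ℝ) ^ ((i : ℤ) + m) * ∑ k ∈ weilPrimeIndex a, w k * ((Λ k : ℝ) / Real.sqrt k) *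
          (((i : ℝ) * Real.sin (freq a m * Real.log k) - m * Real.sin (freq a i * Real.log k))
            / (π * ((m : ℝ) ^ 2 - i ^ 2))) := by
  have hd1 : (i : ℝ) - m ≠ 0 := sub_ne_zero.mpr (by exact_mod_cast (ne_of_lt him))
  have hd1' : (m : ℝ) - i ≠ 0 := sub_ne_zero.mpr (by exact_mod_cast (ne_of_gt him))
  have hd2 : (0 : ℝ) < (i : ℝ) + m := by
    have : (1 : ℝ) ≤ i := by exact_mod_cast hi
    have : (0 : ℝ) ≤ m := by positivity
    linarith
  have hD : (m : ℝ) ^ 2 - i ^ 2 ≠ 0 := by rw [sq_sub_sq]; exact mul_ne_zero (by positivity) hd1'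
  have h1 : (i : ℤ) ≠ m := by exact_mod_cast (ne_of_lt him)
  have h2 : (i : ℤ) ≠ -(m : ℤ) := by omega
  rw [← Finset.sum_sub_distrib, Finset.sum_div, Finset.mul_sum]
  refine Finset.sum_congr rfl fun k _ ↦ ?_
  unfold incrCoeff
  rw [if_neg h1, if_neg h2, if_neg h1, if_neg h2, freq_neg, neg_one_zpow_add_neg]
  push_cast
  simp only [neg_mul, Real.sin_neg, sub_neg_eq_add, sub_zero]
  have hd2' : (i : ℝ) + m ≠ 0 := hd2.ne'
  generalize (Λ k : ℝ) / Real.sqrt k = u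
  generalize Real.sin (freq a m * Real.log k) = sm
  generalize Real.sin (freq a i * Real.log k) = si
  field_simp
  ring

/-- **Twisted prime column remainder, odd sector**: for `|w_k| ≤ 1`, `1 ≤ i`, `2i ≤ m`:
off `−(−1)^{i+m}Σ_k w_k(Λ_k/√k) sin ω_iℓ_k/(πm)` by `≤ (2iΛΣ/π)/m²`. -/
theorem abs_oddTwistedPrime_col_sub_le (w : ℕ → ℝ) (hw : ∀ k, |w k| ≤ 1) (a : ℝ) {i m : ℕ} (hi : 1 ≤ i)
    (him : 2 * i ≤ m) :
    |((∑ k ∈ weilPrimeIndex a, w k * ((Λ k : ℝ) / Real.sqrt k) *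
          (incrCoeff a (Real.log k) i m - if (i : ℤ) = m then 2 else 0)) -
        (∑ k ∈ weilPrimeIndex a, w k * ((Λ k : ℝ) / Real.sqrt k) *
          (incrCoeff a (Real.log k) i (-(m : ℤ)) - if (i : ℤ) = -(m : ℤ) then 2 else 0))) / 2
        + (-1 : ℝ) ^ ((i : ℤ) + m) *
          (∑ k ∈ weilPrimeIndex a, w k * ((Λ k : ℝ) / Real.sqrt k) * Real.sin (freq a i * Real.log k)) / (π * m)|
      ≤ (2 * i * (∑ k ∈ weilPrimeIndex a, (Λ k : ℝ) / Real.sqrt k) / π) / (m : ℝ) ^ 2 := by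
  have hm : 1 ≤ m := by omega
  have him' : i < m := by omega
  have hm0 : (0 : ℝ) < m := by exact_mod_cast hm
  have hi0 : (0 : ℝ) ≤ i := by positivity
  obtain ⟨hD34, hihalf, hDpos⟩ := col_index_bounds' hm him
  rw [oddTwistedPrime_col_eq w a hi him']
  have e : (-1 : ℝ) ^ ((i : ℤ) + m) * ∑ k ∈ weilPrimeIndex a, w k * ((Λ k : ℝ) / Real.sqrt k) *
          (((i : ℝ) * Real.sin (freq a m * Real.log k) - m * Real.sin (freq a i * Real.log k))
            / (π * ((m : ℝ) ^ 2 - i ^ 2)))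
        + (-1 : ℝ) ^ ((i : ℤ) + m) *
          (∑ k ∈ weilPrimeIndex a, w k * ((Λ k : ℝ) / Real.sqrt k) * Real.sin (freq a i * Real.log k)) / (π * m)
      = (-1 : ℝ) ^ ((i : ℤ) + m) * ∑ k ∈ weilPrimeIndex a, w k * ((Λ k : ℝ) / Real.sqrt k) *
          ((((i : ℝ) * Real.sin (freq a m * Real.log k) - m * Real.sin (freq a i * Real.log k))
            / (π * ((m : ℝ) ^ 2 - i ^ 2))) + Real.sin (freq a i * Real.log k) / (π * m)) := by
    rw [mul_div_assoc, Finset.sum_div, ← mul_add, ← Finset.sum_add_distrib]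
    congr 1
    exact Finset.sum_congr rfl fun k _ ↦ by ring
  rw [e, abs_mul, abs_neg_one_zpow_natCast_add', one_mul]
  have hK : ∀ k ∈ weilPrimeIndex a,
      |w k * ((Λ k : ℝ) / Real.sqrt k) *
        ((((i : ℝ) * Real.sin (freq a m * Real.log k) - m * Real.sin (freq a i * Real.log k))
          / (π * ((m : ℝ) ^ 2 - i ^ 2))) + Real.sin (freq a i * Real.log k) / (π * m))|
        ≤ (Λ k : ℝ) / Real.sqrt k * (2 * i / (π * m ^ 2)) := by
    intro k _
    have hu : 0 ≤ (Λ k : ℝ) / Real.sqrt k := div_nonneg ArithmeticFunction.vonMangoldt_nonneg (Real.sqrt_nonneg _)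
    rw [abs_mul, abs_mul, abs_of_nonneg hu]
    have hsm := Real.abs_sin_le_one (freq a m * Real.log k)
    have hsi := Real.abs_sin_le_one (freq a i * Real.log k)
    generalize Real.sin (freq a m * Real.log k) = sm at hsm ⊢
    generalize Real.sin (freq a i * Real.log k) = si at hsi ⊢
    have e : ((i : ℝ) * sm - m * si) / (π * ((m : ℝ) ^ 2 - i ^ 2)) + si / (π * m)
        = ((i : ℝ) * m * sm - i ^ 2 * si) / (π * m * ((m : ℝ) ^ 2 - i ^ 2)) := by
      field_simp
      ring
    have hrest : |((i : ℝ) * sm - m * si) / (π * ((m : ℝ) ^ 2 - i ^ 2)) + si / (π * m)| ≤ 2 * i / (π * m ^ 2) := by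
      rw [e, abs_div, abs_of_pos (by positivity : (0 : ℝ) < π * m * ((m : ℝ) ^ 2 - i ^ 2)),
        div_le_div_iff₀ (by positivity) (by positivity)]
      have hnum : |(i : ℝ) * m * sm - i ^ 2 * si| ≤ (i : ℝ) * m + i ^ 2 := by
        have h1 : |(i : ℝ) * m * sm| ≤ (i : ℝ) * m := by
          rw [abs_mul, abs_of_nonneg (by positivity : (0 : ℝ) ≤ (i : ℝ) * m)]
          exact mul_le_of_le_one_right (by positivity) hsm
        have h2 : |(i : ℝ) ^ 2 * si| ≤ (i : ℝ) ^ 2 := by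
          rw [abs_mul, abs_of_nonneg (by positivity : (0 : ℝ) ≤ (i : ℝ) ^ 2)]
          exact mul_le_of_le_one_right (by positivity) hsi
        exact (abs_sub _ _).trans (add_le_add h1 h2)
      have hlhs := mul_le_mul_of_nonneg_right hnum (by positivity : (0 : ℝ) ≤ π * m ^ 2)
      refine hlhs.trans ?_
      have h2i : (0 : ℝ) ≤ m - 2 * i := by
        have : 2 * (i : ℝ) ≤ m := by exact_mod_cast him
        linarith
      have key : 0 ≤ π * i * m * ((m : ℝ) + i) * (m - 2 * i) := by positivity
      nlinarith [key]
    calc |w k| * ((Λ k : ℝ) / Real.sqrt k) *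
          |((i : ℝ) * sm - m * si) / (π * ((m : ℝ) ^ 2 - i ^ 2)) + si / (π * m)|
        ≤ 1 * ((Λ k : ℝ) / Real.sqrt k) * (2 * i / (π * m ^ 2)) :=
          mul_le_mul (mul_le_mul_of_nonneg_right (hw k) hu) hrest (abs_nonneg _) (by positivity)
      _ = _ := by ring
  refine (Finset.abs_sum_le_sum_abs _ _).trans ((Finset.sum_le_sum hK).trans (le_of_eq ?_))
  rw [← Finset.sum_mul]
  field_simp

/-- **Order-1 column structure for a character, odd sector.**  For `a > 0`, `1 ≤ i`, `2i ≤ m` (modes; kernel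
indices `i−1`, `m−1`): `|M⁻_{twistedGramCoeff χ a}(i,m) − (−1)^{i+m} v⁻_χ(i)/m| ≤ κ⁻_χ(i)/m²` with
`v⁻_χ(i) = −Σ_k Re χ(k)(Λ_k/√k) sin(ω_iℓ_k)/π − Y_i/(2π) + T_i/π` and `κ⁻_χ(i) = 2iΛΣ/π + i/2 + 4a(1+E)/(3π²)`. -/
theorem abs_oddTwistedKernel_col_sub_le (χ : DirichletCharacter ℂ q) (ha : 0 < a) {i m : ℕ} (hi : 1 ≤ i)
    (him : 2 * i ≤ m) :
    |(twistedGramCoeff χ a i m - twistedGramCoeff χ a i (-(m : ℤ))) / 2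
        - (-1 : ℝ) ^ ((i : ℤ) + m) *
          (-(∑ k ∈ weilPrimeIndex a,
              (χ (k : ZMod q)).re * ((Λ k : ℝ) / Real.sqrt k) * Real.sin (freq a i * Real.log k)) / π
            - (Complex.digamma (1 / 4 + ((freq a i : ℝ) : ℂ) / 2 * I)).im / (2 * π) + archExpSumSin a i / π) / m|
      ≤ (2 * i * (∑ k ∈ weilPrimeIndex a, (Λ k : ℝ) / Real.sqrt k) / π
          + ((i : ℝ) / 2 + 4 * a * (1 + weilArchDensity (2 * a)) / (3 * π ^ 2))) / (m : ℝ) ^ 2 := by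
  have hm : 1 ≤ m := by omega
  have him' : i < m := by omega
  have hm0 : (0 : ℝ) < m := by exact_mod_cast hm
  have h1 : (i : ℤ) ≠ m := by exact_mod_cast (ne_of_lt him')
  have h2 : (i : ℤ) ≠ -(m : ℤ) := by omega
  have hw1 : ∀ k, |(fun k : ℕ ↦ (χ (k : ZMod q)).re) k| ≤ 1 := fun k ↦ abs_re_apply_le_one χ k
  have hQ := abs_oddTwistedPrime_col_sub_le (fun k : ℕ ↦ (χ (k : ZMod q)).re) hw1 a hi him
  beta_reduce at hQ
  have hR := abs_oddArch_col_sub_le ha hi him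
  have e : (twistedGramCoeff χ a i m - twistedGramCoeff χ a i (-(m : ℤ))) / 2
        - (-1 : ℝ) ^ ((i : ℤ) + m) *
          (-(∑ k ∈ weilPrimeIndex a,
              (χ (k : ZMod q)).re * ((Λ k : ℝ) / Real.sqrt k) * Real.sin (freq a i * Real.log k)) / π
            - (Complex.digamma (1 / 4 + ((freq a i : ℝ) : ℂ) / 2 * I)).im / (2 * π) + archExpSumSin a i / π) / m
      = (((∑ k ∈ weilPrimeIndex a, (χ (k : ZMod q)).re * ((Λ k : ℝ) / Real.sqrt k) *
              (incrCoeff a (Real.log k) i m - if (i : ℤ) = m then 2 else 0)) -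
            (∑ k ∈ weilPrimeIndex a, (χ (k : ZMod q)).re * ((Λ k : ℝ) / Real.sqrt k) *
              (incrCoeff a (Real.log k) i (-(m : ℤ)) - if (i : ℤ) = -(m : ℤ) then 2 else 0))) / 2
          + (-1 : ℝ) ^ ((i : ℤ) + m) *
            (∑ k ∈ weilPrimeIndex a, (χ (k : ZMod q)).re * ((Λ k : ℝ) / Real.sqrt k) *
              Real.sin (freq a i * Real.log k)) / (π * m))
        + ((archCoeff a i m - archCoeff a i (-(m : ℤ))) / 2
          - (-1 : ℝ) ^ ((i : ℤ) + m) *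
            (-(Complex.digamma (1 / 4 + ((freq a i : ℝ) : ℂ) / 2 * I)).im / (2 * π) + archExpSumSin a i / π) / m) := by
    rw [twistedGramCoeff_eq_arch_add_prime_add_conductor, twistedGramCoeff_eq_arch_add_prime_add_conductor]
    simp only [if_neg h1, if_neg h2]
    field_simp
    ring
  rw [e]
  refine ((abs_add_le _ _).trans (add_le_add hQ hR)).trans (le_of_eq ?_)
  ring

end Odd

end Summit.Ventures.WeilGRH

end
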